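import Literature.Algebra.Bialgebra.DegreeTwoCupSurjectiveOfKunneth
import HarnessLib

/-!
# `H¹ ∪ H¹ = H²` for a connected graded bialgebra with Künneth decomposition, from TOP-DEGREE ANNIHILATION (any characteristic)

The characteristic-free replacement of ★ `Literature.Algebra.Bialgebra.cup_one_one_surjective` (which needs `char k = 0` through the
power argument of ★ `NoPrimitiveInDegreeTwo`).  SETTING: the PIECES axiomatics of ★ `DegreeTwoCupSurjectiveOfKunneth` — graded pieces
`HA n = Ȟⁿ(A)`, `HS n = Ȟⁿ(A × A)` with cup products carrying their target degree, degree-preserving multiplicative maps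
`m, p₁, p₂ : HA → HS` («`m^*, p₁^*, p₂^*`») and slices `i₁, i₂ : HS → HA`, units, the augmentation `aug` (connectedness), associativity and
graded commutativity of `HS`, and the KÜNNETH decomposition of `HS n` by the classes `p₁^*y ∪ p₂^*z` (injectivity `hinj`, surjectivity `hsurj`).
NEW INPUTS instead of `CharZero k` and boundedness: (K2) a top degree `N` (`HA n = 0` for `n > N`) and (K3) degree-one classes `v 0, v 1, …`
whose iterated product `ω (N-1) = (⋯(1 ∪ v 0) ∪ v 1 ⋯) ∪ v (N-2) ∈ HA (N-1)` is NON-ZERO.  CONCLUSION (`cup_one_one_surjective_of_topDegree`):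
**the cup product `HA 1 ⊗ HA 1 → HA 2` is onto.**

PROOF («top-degree annihilation»).  For `x : HA 2` follow `y_j := (⋯(x ∪ v 0) ∪ ⋯) ∪ v (j-1) ∈ HA (j+2)` and the Künneth decomposition
`m^* y_j = Σ_{c+d=j+2} p₁^*(·) ∪ p₂^*(·)` of its coproduct: multiplying by `m^* v = p₁^*v + p₂^*v` shifts the bidegree-`(c,d)` component to
`(c+1,d)` (with the sign `(-1)^d`) and to `(c,d+1)` (`kunneth_cup_pOne`, `kunneth_cup_pTwo`, `coproduct_cup_degree_one_step`), so the
`(2, j)` component stays congruent to `x ⊗ ω j` modulo `(H¹ ∪ H¹) ⊗ HA j` (the new contributions come from `(1, j)`, whose first factors get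
multiplied by a degree-one class).  At `j = N - 1` the class `y_j` has degree `N + 1`, hence vanishes, so every Künneth component of
`m^* y_j = 0` vanishes (`hinj`): `x ⊗ ω (N-1) ∈ (H¹ ∪ H¹) ⊗ HA (N-1)`, and contracting with a linear functional that is `1` on `ω (N-1)`
(`mem_range_of_tmul_mem_range_map`) gives `x ∈ H¹ ∪ H¹`.  No hypothesis on the characteristic, no `⅟2`, no graded commutativity of `HA`,
no Borel–Hopf structure theory.  (For `Λ•V ⊗ k[y]/(y^p)`, `deg y = 2` — the characteristic-`p` bialgebra where `H² ≠ H¹ ∪ H¹` — the top degree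
is `dim V + 2(p-1)` and (K3) fails, as it must.)

This is the degree-two shadow of [GortzWedhorn2023] Cor. 27.79 («`H^i = 0` for `i > g` and `dim H¹ = g` force `H• ≅ Λ•H¹`», there via
Borel–Hopf Thm. 27.78) and of [MumfordAV1970] §13 Cor. 2; for an abelian variety of dimension `g` over ANY field it is instantiated with
`N = g` on an affine cover with `g + 1` members (★ `ProjectiveGeometry/AffineCoverOfCardDimSucc`, ★ `OrderedCech.eq_zero_of_card_le`) and the
`H¹`-count `dim Ȟ¹(A, 𝒪_A) = g` (★ `MumfordDual.finite_finrank_cechH1_eq_dim_of_letter_field` on road (A)).  Pure linear algebra; no definition,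
no named fact, no `sorry`; Mathlib + the ★ file only.  Cell `hodgecm-mathlib` (D-0151), P6 word «M-131» (ii), (U-ab-K) census (A-p12 (g30));
count-neutral; HC_CM is proved only modulo the 7 printed citations until rung 0 closes, and nothing here bears on it.

## References
* [GortzWedhorn2023] U. Görtz, T. Wedhorn, *Algebraic Geometry II: Cohomology of Schemes* (2023), (27.12) Thm. 27.78, Cor. 27.79, Cor. 27.80;
  (27.38) Cor. 27.200.
* [MumfordAV1970] D. Mumford, *Abelian Varieties* (1970), §13 Cor. 2 (p. 129).
* [MilnorMoore1965] J. W. Milnor, J. C. Moore, *On the structure of Hopf algebras*, Ann. of Math. (2) 81 (1965), §3 Prop. 3.9 (p. 225),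
  §7 Prop. 7.8 (p. 253), Thm. 7.11 (p. 255).
-/

namespace Literature.Algebra.Bialgebra

open TensorProduct Finset

universe u v w

/-! ### Contraction with a linear functional -/

section Contraction

variable {k : Type u} [Field k] {V : Type*} {M : Type*} {W : Type*}
  [AddCommGroup V] [Module k V] [AddCommGroup M] [Module k M] [AddCommGroup W] [Module k W]

/-- **Contraction**: over a field, if `x ⊗ w` lies in the image of `f ⊗ id : V ⊗ W → M ⊗ W` and `w ≠ 0`, then `x` lies in the image
of `f` (apply `id ⊗ φ` for a functional `φ` with `φ w = 1`). [cite: MilnorMoore1965, §3 Prop. 3.9 (p. 225)] -/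
theorem mem_range_of_tmul_mem_range_map (f : V →ₗ[k] M) {x : M} {w : W} (hw : w ≠ 0)
    (h : x ⊗ₜ[k] w ∈ LinearMap.range (TensorProduct.map f (LinearMap.id : W →ₗ[k] W))) :
    x ∈ LinearMap.range f := by
  obtain ⟨φ, hφ⟩ : ∃ φ : Module.Dual k W, φ w = 1 := by
    obtain ⟨ψ, hψ⟩ : ∃ ψ : Module.Dual k W, ψ w ≠ 0 := by
      by_contra hcon
      exact hw ((Module.forall_dual_apply_eq_zero_iff k w).mp fun φ => not_not.mp (not_exists.mp hcon φ))
    exact ⟨(ψ w)⁻¹ • ψ, by rw [LinearMap.smul_apply, smul_eq_mul, inv_mul_cancel₀ hψ]⟩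
  obtain ⟨u, hu⟩ := h
  have key : ∀ u : V ⊗[k] W, (TensorProduct.rid k M) (LinearMap.lTensor M φ (TensorProduct.map f LinearMap.id u)) =
      f ((TensorProduct.rid k V) (LinearMap.lTensor V φ u)) := by
    intro u
    induction u using TensorProduct.induction_on with
    | zero => simp
    | tmul a b =>
      rw [TensorProduct.map_tmul, LinearMap.lTensor_tmul, TensorProduct.rid_tmul, LinearMap.lTensor_tmul,
        TensorProduct.rid_tmul, LinearMap.id_apply, map_smul]
    | add s s' hs hs' => simp only [map_add, hs, hs']
  refine ⟨(TensorProduct.rid k V) (LinearMap.lTensor V φ u), ?_⟩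
  rw [← key, hu, LinearMap.lTensor_tmul, TensorProduct.rid_tmul, hφ, one_smul]

end Contraction

section TopDegree

variable {k : Type u} [Field k]
  {HA : ℕ → Type v} [∀ i, AddCommGroup (HA i)] [∀ i, Module k (HA i)]
  {HS : ℕ → Type w} [∀ i, AddCommGroup (HS i)] [∀ i, Module k (HS i)]
  {cupA : ∀ a b n : ℕ, a + b = n → HA a →ₗ[k] HA b →ₗ[k] HA n}
  {cupS : ∀ a b n : ℕ, a + b = n → HS a →ₗ[k] HS b →ₗ[k] HS n}
  {m p₁ p₂ : ∀ n : ℕ, HA n →ₗ[k] HS n} {i₁ i₂ : ∀ n : ℕ, HS n →ₗ[k] HA n}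
  {oneA : HA 0} {oneS : HS 0} {aug : HA 0 →ₗ[k] k}

/-! ### Multiplying a Künneth class by `p₁^*v` and by `p₂^*v` (`v` of degree one) -/

/-- `(p₁^*y ∪ p₂^*z) ∪ p₁^*v = (-1)^{deg z} · p₁^*(y ∪ v) ∪ p₂^*z` for `v` of degree one, extended linearly in `y ⊗ z`: multiplying the
Künneth class of `t ∈ HA a ⊗ HA b` by `p₁^*v` gives `(-1)^b` times the Künneth class of `((· ∪ v) ⊗ id) t` in bidegree `(a+1, b)`.
[cite: MumfordAV1970, §13 Cor. 2 (p. 129), proof] -/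
theorem kunneth_cup_pOne
    (hp₁_mul : ∀ (a b n : ℕ) (h : a + b = n) (y : HA a) (z : HA b),
      p₁ n (cupA a b n h y z) = cupS a b n h (p₁ a y) (p₁ b z))
    (hassoc : ∀ (a b c ab bc n : ℕ) (hab : a + b = ab) (hbc : b + c = bc) (h : ab + c = n)
      (y : HS a) (z : HS b) (w : HS c),
      cupS ab c n h (cupS a b ab hab y z) w = cupS a bc n (by omega) y (cupS b c bc hbc z w))
    (hcomm : ∀ (a b n : ℕ) (h : a + b = n) (y : HS a) (z : HS b),
      cupS a b n h y z = ((-1 : k) ^ (a * b)) • cupS b a n (by omega) z y)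
    (a b n : ℕ) (h : a + b = n) (v : HA 1) (t : HA a ⊗[k] HA b) :
    cupS n 1 (n + 1) rfl (TensorProduct.lift ((cupS a b n h).compl₁₂ (p₁ a) (p₂ b)) t) (p₁ 1 v) =
      ((-1 : k) ^ b) • TensorProduct.lift ((cupS (a + 1) b (n + 1) (by omega)).compl₁₂ (p₁ (a + 1)) (p₂ b))
        (TensorProduct.map ((cupA a 1 (a + 1) rfl).flip v) LinearMap.id t) := by
  induction t using TensorProduct.induction_on with
  | zero => simp
  | tmul y z =>
    rw [TensorProduct.lift.tmul, LinearMap.compl₁₂_apply, TensorProduct.map_tmul, TensorProduct.lift.tmul,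
      LinearMap.compl₁₂_apply, LinearMap.flip_apply, LinearMap.id_apply, hp₁_mul,
      hassoc a b 1 n (b + 1) (n + 1) h rfl rfl, hcomm b 1 (b + 1) rfl (p₂ b z) (p₁ 1 v), mul_one, map_smul,
      ← hassoc a 1 b (a + 1) (b + 1) (n + 1) rfl (by omega) (by omega)]
  | add s s' hs hs' => simp only [map_add, LinearMap.add_apply, hs, hs', smul_add]

/-- `(p₁^*y ∪ p₂^*z) ∪ p₂^*v = p₁^*y ∪ p₂^*(z ∪ v)`, extended linearly: multiplying the Künneth class of `t ∈ HA a ⊗ HA b` by `p₂^*v`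
gives the Künneth class of `(id ⊗ (· ∪ v)) t` in bidegree `(a, b+1)`. [cite: MumfordAV1970, §13 Cor. 2 (p. 129), proof] -/
theorem kunneth_cup_pTwo
    (hp₂_mul : ∀ (a b n : ℕ) (h : a + b = n) (y : HA a) (z : HA b),
      p₂ n (cupA a b n h y z) = cupS a b n h (p₂ a y) (p₂ b z))
    (hassoc : ∀ (a b c ab bc n : ℕ) (hab : a + b = ab) (hbc : b + c = bc) (h : ab + c = n)
      (y : HS a) (z : HS b) (w : HS c),
      cupS ab c n h (cupS a b ab hab y z) w = cupS a bc n (by omega) y (cupS b c bc hbc z w))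
    (a b n : ℕ) (h : a + b = n) (v : HA 1) (t : HA a ⊗[k] HA b) :
    cupS n 1 (n + 1) rfl (TensorProduct.lift ((cupS a b n h).compl₁₂ (p₁ a) (p₂ b)) t) (p₂ 1 v) =
      TensorProduct.lift ((cupS a (b + 1) (n + 1) (by omega)).compl₁₂ (p₁ a) (p₂ (b + 1)))
        (TensorProduct.map LinearMap.id ((cupA b 1 (b + 1) rfl).flip v) t) := by
  induction t using TensorProduct.induction_on with
  | zero => simp
  | tmul y z =>
    rw [TensorProduct.lift.tmul, LinearMap.compl₁₂_apply, TensorProduct.map_tmul, TensorProduct.lift.tmul,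
      LinearMap.compl₁₂_apply, LinearMap.flip_apply, LinearMap.id_apply, hp₂_mul,
      hassoc a b 1 n (b + 1) (n + 1) h rfl rfl]
  | add s s' hs hs' => simp only [map_add, LinearMap.add_apply, hs, hs']

/-! ### One step: the Künneth decomposition of `m^*(y ∪ v)` from that of `m^*y` -/

/-- **Coproduct of `y ∪ v`, `v` of degree one, from the Künneth decomposition of `m^*y`.**  If
`m^*y = Σ_{c+d=n} p₁^*(·) ∪ p₂^*(·)` with components `t (c,d) ∈ HA c ⊗ HA d`, then `m^*(y ∪ v)` (with `m^*v = p₁^*v + p₂^*v`) has a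
Künneth decomposition whose component of bidegree `(c+1, d+1)` is `(-1)^{d+1} · ((· ∪ v) ⊗ id)(t (c, d+1)) + (id ⊗ (· ∪ v))(t (c+1, d))`,
of bidegree `(0, d+1)` is `(id ⊗ (· ∪ v))(t (0, d))`, and of bidegree `(c+1, 0)` is `((· ∪ v) ⊗ id)(t (c, 0))`.
[cite: MumfordAV1970, §13 Cor. 2 (p. 129), proof] [cite: MilnorMoore1965, §3 Prop. 3.9 (p. 225)] -/
theorem coproduct_cup_degree_one_step
    (hm_mul : ∀ (a b n : ℕ) (h : a + b = n) (y : HA a) (z : HA b),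
      m n (cupA a b n h y z) = cupS a b n h (m a y) (m b z))
    (hp₁_mul : ∀ (a b n : ℕ) (h : a + b = n) (y : HA a) (z : HA b),
      p₁ n (cupA a b n h y z) = cupS a b n h (p₁ a y) (p₁ b z))
    (hp₂_mul : ∀ (a b n : ℕ) (h : a + b = n) (y : HA a) (z : HA b),
      p₂ n (cupA a b n h y z) = cupS a b n h (p₂ a y) (p₂ b z))
    (hassoc : ∀ (a b c ab bc n : ℕ) (hab : a + b = ab) (hbc : b + c = bc) (h : ab + c = n)
      (y : HS a) (z : HS b) (w : HS c),
      cupS ab c n h (cupS a b ab hab y z) w = cupS a bc n (by omega) y (cupS b c bc hbc z w))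
    (hcomm : ∀ (a b n : ℕ) (h : a + b = n) (y : HS a) (z : HS b),
      cupS a b n h y z = ((-1 : k) ^ (a * b)) • cupS b a n (by omega) z y)
    (hdeg1 : ∀ a : HA 1, m 1 a = p₁ 1 a + p₂ 1 a)
    (n : ℕ) (y : HA n) (v : HA 1) (t : ∀ p : ℕ × ℕ, HA p.1 ⊗[k] HA p.2)
    (ht : m n y = ∑ p ∈ antidiagonal n, (if h : p.1 + p.2 = n then
      TensorProduct.lift ((cupS p.1 p.2 n h).compl₁₂ (p₁ p.1) (p₂ p.2)) (t p) else 0)) :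
    ∃ t' : ∀ p : ℕ × ℕ, HA p.1 ⊗[k] HA p.2,
      m (n + 1) (cupA n 1 (n + 1) rfl y v) = ∑ p ∈ antidiagonal (n + 1), (if h : p.1 + p.2 = n + 1 then
        TensorProduct.lift ((cupS p.1 p.2 (n + 1) h).compl₁₂ (p₁ p.1) (p₂ p.2)) (t' p) else 0) ∧
      (∀ c d : ℕ, t' (c + 1, d + 1) =
        ((-1 : k) ^ (d + 1)) • TensorProduct.map ((cupA c 1 (c + 1) rfl).flip v) LinearMap.id (t (c, d + 1)) +
          TensorProduct.map LinearMap.id ((cupA d 1 (d + 1) rfl).flip v) (t (c + 1, d))) ∧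
      (∀ d : ℕ, t' (0, d + 1) = TensorProduct.map LinearMap.id ((cupA d 1 (d + 1) rfl).flip v) (t (0, d))) ∧
      (∀ c : ℕ, t' (c + 1, 0) = ((-1 : k) ^ 0) • TensorProduct.map ((cupA c 1 (c + 1) rfl).flip v) LinearMap.id (t (c, 0))) := by
  classical
  -- the two shifted families
  let A : ∀ p : ℕ × ℕ, HA p.1 ⊗[k] HA p.2 := fun p =>
    match p with
    | (0, _) => 0
    | (c + 1, d) => ((-1 : k) ^ d) • TensorProduct.map ((cupA c 1 (c + 1) rfl).flip v) LinearMap.id (t (c, d))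
  let B : ∀ p : ℕ × ℕ, HA p.1 ⊗[k] HA p.2 := fun p =>
    match p with
    | (_, 0) => 0
    | (c, d + 1) => TensorProduct.map LinearMap.id ((cupA d 1 (d + 1) rfl).flip v) (t (c, d))
  refine ⟨fun p => A p + B p, ?_, fun c d => rfl, fun d => zero_add _, fun c => add_zero _⟩
  -- `m^*(y ∪ v) = m^*y ∪ p₁^*v + m^*y ∪ p₂^*v`
  rw [hm_mul, hdeg1, map_add, ht, map_sum, LinearMap.sum_apply, LinearMap.sum_apply]
  -- the two sums, term by term
  have h1 : ∀ p ∈ antidiagonal n,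
      cupS n 1 (n + 1) rfl (if h : p.1 + p.2 = n then
        TensorProduct.lift ((cupS p.1 p.2 n h).compl₁₂ (p₁ p.1) (p₂ p.2)) (t p) else 0) (p₁ 1 v) =
      (if h : (p.1 + 1) + p.2 = n + 1 then
        TensorProduct.lift ((cupS (p.1 + 1) p.2 (n + 1) h).compl₁₂ (p₁ (p.1 + 1)) (p₂ p.2)) (A (p.1 + 1, p.2)) else 0) := by
    intro p hp
    have hpn : p.1 + p.2 = n := mem_antidiagonal.mp hp
    rw [dif_pos hpn, dif_pos (by omega), kunneth_cup_pOne hp₁_mul hassoc hcomm p.1 p.2 n hpn v (t p), ← map_smul]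
  have h2 : ∀ p ∈ antidiagonal n,
      cupS n 1 (n + 1) rfl (if h : p.1 + p.2 = n then
        TensorProduct.lift ((cupS p.1 p.2 n h).compl₁₂ (p₁ p.1) (p₂ p.2)) (t p) else 0) (p₂ 1 v) =
      (if h : p.1 + (p.2 + 1) = n + 1 then
        TensorProduct.lift ((cupS p.1 (p.2 + 1) (n + 1) h).compl₁₂ (p₁ p.1) (p₂ (p.2 + 1))) (B (p.1, p.2 + 1)) else 0) := by
    intro p hp
    have hpn : p.1 + p.2 = n := mem_antidiagonal.mp hp
    rw [dif_pos hpn, dif_pos (by omega), kunneth_cup_pTwo hp₂_mul hassoc p.1 p.2 n hpn v (t p)]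
  rw [Finset.sum_congr rfl h1, Finset.sum_congr rfl h2]
  -- split the target sum into its `A`- and `B`-parts and re-index
  have hsplit : ∀ p ∈ antidiagonal (n + 1),
      (if h : p.1 + p.2 = n + 1 then
        TensorProduct.lift ((cupS p.1 p.2 (n + 1) h).compl₁₂ (p₁ p.1) (p₂ p.2)) (A p + B p) else 0) =
      (if h : p.1 + p.2 = n + 1 then
        TensorProduct.lift ((cupS p.1 p.2 (n + 1) h).compl₁₂ (p₁ p.1) (p₂ p.2)) (A p) else 0) +
      (if h : p.1 + p.2 = n + 1 then
        TensorProduct.lift ((cupS p.1 p.2 (n + 1) h).compl₁₂ (p₁ p.1) (p₂ p.2)) (B p) else 0) := by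
    intro p _
    split_ifs
    · rw [map_add]
    · rw [add_zero]
  rw [Finset.sum_congr rfl hsplit, Finset.sum_add_distrib, Finset.Nat.sum_antidiagonal_succ (n := n),
    Finset.Nat.sum_antidiagonal_succ' (n := n)]
  have hA0 : (if h : ((0 : ℕ), n + 1).1 + ((0 : ℕ), n + 1).2 = n + 1 then
      TensorProduct.lift ((cupS ((0 : ℕ), n + 1).1 ((0 : ℕ), n + 1).2 (n + 1) h).compl₁₂ (p₁ ((0 : ℕ), n + 1).1)
        (p₂ ((0 : ℕ), n + 1).2)) (A ((0 : ℕ), n + 1)) else 0) = 0 := by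
    split_ifs
    · exact map_zero _
    · rfl
  have hB0 : (if h : (n + 1, (0 : ℕ)).1 + (n + 1, (0 : ℕ)).2 = n + 1 then
      TensorProduct.lift ((cupS (n + 1, (0 : ℕ)).1 (n + 1, (0 : ℕ)).2 (n + 1) h).compl₁₂ (p₁ (n + 1, (0 : ℕ)).1)
        (p₂ (n + 1, (0 : ℕ)).2)) (B (n + 1, (0 : ℕ))) else 0) = 0 := by
    split_ifs
    · exact map_zero _
    · rfl
  rw [hA0, hB0, zero_add, zero_add]

/-! ### The base: the Künneth decomposition of `m^*x`, `x` of degree two, with outer components `x ⊗ 1` and `1 ⊗ x` -/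

/-- **`m^*x = p₁^*x ∪ p₂^*1 + κ(s) + p₁^*1 ∪ p₂^*x`** as a Künneth decomposition with the component of bidegree `(2,0)` EQUAL to
`x ⊗ 1` (★ `coproduct_degree_two`, re-packaged as a family over the antidiagonal). [cite: MumfordAV1970, §13 Cor. 2 (p. 129), proof] -/
theorem coproduct_degree_two_family (haug : ∀ z : HA 0, z = aug z • oneA) (hp₁_one : p₁ 0 oneA = oneS)
    (hp₂_one : p₂ 0 oneA = oneS) (honeS_left : ∀ (b : ℕ) (y : HS b), cupS 0 b b (by omega) oneS y = y)
    (honeS_right : ∀ (a : ℕ) (y : HS a), cupS a 0 a (by omega) y oneS = y)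
    (hi₁_mul : ∀ (a b n : ℕ) (h : a + b = n) (Y : HS a) (Z : HS b),
      i₁ n (cupS a b n h Y Z) = cupA a b n h (i₁ a Y) (i₁ b Z))
    (hi₂_mul : ∀ (a b n : ℕ) (h : a + b = n) (Y : HS a) (Z : HS b),
      i₂ n (cupS a b n h Y Z) = cupA a b n h (i₂ a Y) (i₂ b Z))
    (hi₁m : ∀ (n : ℕ) (y : HA n), i₁ n (m n y) = y) (hi₂m : ∀ (n : ℕ) (y : HA n), i₂ n (m n y) = y)
    (hi₁p₁ : ∀ (n : ℕ) (y : HA n), i₁ n (p₁ n y) = y) (hi₂p₂ : ∀ (n : ℕ) (y : HA n), i₂ n (p₂ n y) = y)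
    (hi₁p₂ : ∀ (n : ℕ), 1 ≤ n → ∀ (y : HA n), i₁ n (p₂ n y) = 0)
    (hi₂p₁ : ∀ (n : ℕ), 1 ≤ n → ∀ (y : HA n), i₂ n (p₁ n y) = 0)
    (hsurj : ∀ (n : ℕ) (z : HS n), ∃ t : ∀ p : ℕ × ℕ, HA p.1 ⊗[k] HA p.2,
      z = ∑ p ∈ antidiagonal n, (if h : p.1 + p.2 = n then
        TensorProduct.lift ((cupS p.1 p.2 n h).compl₁₂ (p₁ p.1) (p₂ p.2)) (t p) else 0))
    (x : HA 2) :
    ∃ t : ∀ p : ℕ × ℕ, HA p.1 ⊗[k] HA p.2,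
      m 2 x = ∑ p ∈ antidiagonal 2, (if h : p.1 + p.2 = 2 then
        TensorProduct.lift ((cupS p.1 p.2 2 h).compl₁₂ (p₁ p.1) (p₂ p.2)) (t p) else 0) ∧
      t (2, 0) = x ⊗ₜ oneA := by
  obtain ⟨s, hs⟩ := coproduct_degree_two haug hp₁_one hp₂_one honeS_left honeS_right hi₁_mul hi₂_mul hi₁m hi₂m
    hi₁p₁ hi₂p₂ hi₁p₂ hi₂p₁ hsurj x
  set t₀ : ∀ p : ℕ × ℕ, HA p.1 ⊗[k] HA p.2 := fun p => match p with
    | (2, 0) => x ⊗ₜ oneA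
    | (1, 1) => s
    | (0, 2) => oneA ⊗ₜ x
    | _ => 0 with ht₀
  have h20 : t₀ (2, 0) = x ⊗ₜ oneA := rfl
  have h11 : t₀ (1, 1) = s := rfl
  have h02 : t₀ (0, 2) = oneA ⊗ₜ x := rfl
  refine ⟨t₀, ?_, h20⟩
  rw [hs, sum_antidiagonal_two]
  dsimp only
  rw [dif_pos (show 0 + 2 = 2 from rfl), dif_pos (show 1 + 1 = 2 from rfl), dif_pos (show 2 + 0 = 2 from rfl),
    h20, h11, h02, TensorProduct.lift.tmul, LinearMap.compl₁₂_apply, hp₁_one, honeS_left, TensorProduct.lift.tmul,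
    LinearMap.compl₁₂_apply, hp₂_one, honeS_right]
  abel

/-! ### The assembly -/

/-- **`H¹ ∪ H¹ = H²` from top-degree annihilation (any characteristic).**  In the pieces axiomatics of ★
`cup_one_one_surjective` (multiplicativity and unitality of `m, p₁, p₂, i₁, i₂`, slice composites, associativity and graded
commutativity of `HS`, Künneth injectivity ∕ surjectivity, connectedness `aug`) — WITHOUT `CharZero k` — suppose (K2) `HA n = 0` for all
`n > N` and (K3) the iterated product `ω (N-1)` of degree-one classes `v j` (`ω 0 = 1`, `ω (j+1) = ω j ∪ v j`) is non-zero.  Then the cup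
product `HA 1 ⊗ HA 1 → HA 2` is surjective.  For an abelian variety of dimension `g` over any field: `N = g` (affine cover with `g+1`
members) and `dim Ȟ¹(A,𝒪_A) = g`. [cite: GortzWedhorn2023, Cor. 27.79] [cite: GortzWedhorn2023, Cor. 27.200] [cite: MumfordAV1970, §13 Cor. 2 (p. 129)] -/
theorem cup_one_one_surjective_of_topDegree
    (haug : ∀ z : HA 0, z = aug z • oneA) (hp₁_one : p₁ 0 oneA = oneS) (hp₂_one : p₂ 0 oneA = oneS)
    (honeS_left : ∀ (b : ℕ) (y : HS b), cupS 0 b b (by omega) oneS y = y)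
    (honeS_right : ∀ (a : ℕ) (y : HS a), cupS a 0 a (by omega) y oneS = y)
    (hm_mul : ∀ (a b n : ℕ) (h : a + b = n) (y : HA a) (z : HA b),
      m n (cupA a b n h y z) = cupS a b n h (m a y) (m b z))
    (hp₁_mul : ∀ (a b n : ℕ) (h : a + b = n) (y : HA a) (z : HA b),
      p₁ n (cupA a b n h y z) = cupS a b n h (p₁ a y) (p₁ b z))
    (hp₂_mul : ∀ (a b n : ℕ) (h : a + b = n) (y : HA a) (z : HA b),
      p₂ n (cupA a b n h y z) = cupS a b n h (p₂ a y) (p₂ b z))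
    (hi₁_mul : ∀ (a b n : ℕ) (h : a + b = n) (Y : HS a) (Z : HS b),
      i₁ n (cupS a b n h Y Z) = cupA a b n h (i₁ a Y) (i₁ b Z))
    (hi₂_mul : ∀ (a b n : ℕ) (h : a + b = n) (Y : HS a) (Z : HS b),
      i₂ n (cupS a b n h Y Z) = cupA a b n h (i₂ a Y) (i₂ b Z))
    (hi₁m : ∀ (n : ℕ) (y : HA n), i₁ n (m n y) = y) (hi₂m : ∀ (n : ℕ) (y : HA n), i₂ n (m n y) = y)
    (hi₁p₁ : ∀ (n : ℕ) (y : HA n), i₁ n (p₁ n y) = y) (hi₂p₂ : ∀ (n : ℕ) (y : HA n), i₂ n (p₂ n y) = y)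
    (hi₁p₂ : ∀ (n : ℕ), 1 ≤ n → ∀ (y : HA n), i₁ n (p₂ n y) = 0)
    (hi₂p₁ : ∀ (n : ℕ), 1 ≤ n → ∀ (y : HA n), i₂ n (p₁ n y) = 0)
    (hassoc : ∀ (a b c ab bc n : ℕ) (hab : a + b = ab) (hbc : b + c = bc) (h : ab + c = n)
      (y : HS a) (z : HS b) (w : HS c),
      cupS ab c n h (cupS a b ab hab y z) w = cupS a bc n (by omega) y (cupS b c bc hbc z w))
    (hcomm : ∀ (a b n : ℕ) (h : a + b = n) (y : HS a) (z : HS b),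
      cupS a b n h y z = ((-1 : k) ^ (a * b)) • cupS b a n (by omega) z y)
    (hinj : ∀ (ι : Type) (s : Finset ι) (deg : ι → ℕ × ℕ) (_ : Set.InjOn deg s) (n : ℕ)
      (t : ∀ i, HA (deg i).1 ⊗[k] HA (deg i).2),
      (∑ i ∈ s, (if h : (deg i).1 + (deg i).2 = n then
        TensorProduct.lift ((cupS (deg i).1 (deg i).2 n h).compl₁₂ (p₁ (deg i).1) (p₂ (deg i).2)) (t i)
        else 0)) = 0 →
      ∀ i ∈ s, (deg i).1 + (deg i).2 = n → t i = 0)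
    (hsurj : ∀ (n : ℕ) (z : HS n), ∃ t : ∀ p : ℕ × ℕ, HA p.1 ⊗[k] HA p.2,
      z = ∑ p ∈ antidiagonal n, (if h : p.1 + p.2 = n then
        TensorProduct.lift ((cupS p.1 p.2 n h).compl₁₂ (p₁ p.1) (p₂ p.2)) (t p) else 0))
    (N : ℕ) (hN : ∀ n : ℕ, N < n → ∀ y : HA n, y = 0)
    (v : ℕ → HA 1) (ω : ∀ j : ℕ, HA j) (hω0 : ω 0 = oneA)
    (hωs : ∀ j : ℕ, ω (j + 1) = cupA j 1 (j + 1) rfl (ω j) (v j)) (hω : ω (N - 1) ≠ 0) :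
    Function.Surjective (TensorProduct.lift (cupA 1 1 2 rfl)) := by
  classical
  intro x
  -- trivial top degree
  rcases Nat.eq_zero_or_pos N with hN0 | hNpos
  · exact ⟨0, by rw [map_zero, hN 2 (by omega) x]⟩
  obtain ⟨M, rfl⟩ : ∃ M, N = M + 1 := ⟨N - 1, by omega⟩
  have hωM : ω M ≠ 0 := hω
  -- degree-one classes are primitive
  have hdeg1 : ∀ a : HA 1, m 1 a = p₁ 1 a + p₂ 1 a :=
    coproduct_degree_one haug hp₁_one hp₂_one honeS_left honeS_right hi₁m hi₂m hi₁p₁ hi₂p₂ hi₁p₂ hi₂p₁ hsurj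
  -- the invariant along `y_j = (⋯(x ∪ v 0) ∪ ⋯) ∪ v (j-1)`
  have inv : ∀ j : ℕ, ∃ (y : HA (j + 2)) (t : ∀ p : ℕ × ℕ, HA p.1 ⊗[k] HA p.2),
      m (j + 2) y = ∑ p ∈ antidiagonal (j + 2), (if h : p.1 + p.2 = j + 2 then
        TensorProduct.lift ((cupS p.1 p.2 (j + 2) h).compl₁₂ (p₁ p.1) (p₂ p.2)) (t p) else 0) ∧
      t (2, j) - x ⊗ₜ ω j ∈ LinearMap.range
        (TensorProduct.map (TensorProduct.lift (cupA 1 1 2 rfl)) (LinearMap.id : HA j →ₗ[k] HA j)) := by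
    intro j
    induction j with
    | zero =>
      obtain ⟨t, ht, ht20⟩ := coproduct_degree_two_family haug hp₁_one hp₂_one honeS_left honeS_right hi₁_mul hi₂_mul
        hi₁m hi₂m hi₁p₁ hi₂p₂ hi₁p₂ hi₂p₁ hsurj x
      exact ⟨x, t, ht, by rw [ht20, hω0, sub_self]; exact zero_mem _⟩
    | succ j ih =>
      obtain ⟨y, t, ht, hmem⟩ := ih
      obtain ⟨t', ht', hstep, -, -⟩ :=
        coproduct_cup_degree_one_step hm_mul hp₁_mul hp₂_mul hassoc hcomm hdeg1 (j + 2) y (v j) t ht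
      refine ⟨cupA (j + 2) 1 (j + 3) rfl y (v j), t', ht', ?_⟩
      have e : t' (2, j + 1) =
          ((-1 : k) ^ (j + 1)) • TensorProduct.map ((cupA 1 1 2 rfl).flip (v j)) LinearMap.id (t (1, j + 1)) +
            TensorProduct.map LinearMap.id ((cupA j 1 (j + 1) rfl).flip (v j)) (t (2, j)) := hstep 1 j
      rw [e]
      -- `(-1)^{j+1} ((· ∪ v) ⊗ id)(t (1, j+1))` has first factors in `H¹ ∪ H¹`
      have hfirst : ∀ u : HA 1 ⊗[k] HA (j + 1),
          TensorProduct.map ((cupA 1 1 2 rfl).flip (v j)) LinearMap.id u ∈ LinearMap.range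
            (TensorProduct.map (TensorProduct.lift (cupA 1 1 2 rfl)) (LinearMap.id : HA (j + 1) →ₗ[k] HA (j + 1))) := by
        intro u
        induction u using TensorProduct.induction_on with
        | zero => rw [map_zero]; exact zero_mem _
        | tmul a z =>
          refine ⟨(a ⊗ₜ v j) ⊗ₜ z, ?_⟩
          rw [TensorProduct.map_tmul, TensorProduct.map_tmul, TensorProduct.lift.tmul, LinearMap.flip_apply,
            LinearMap.id_apply]
        | add s s' hs hs' => rw [map_add]; exact add_mem hs hs'
      -- `(id ⊗ (· ∪ v))` preserves `(H¹ ∪ H¹) ⊗ -` and moves `x ⊗ ω j` to `x ⊗ ω (j+1)`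
      have hsecond : ∀ r : HA 2 ⊗[k] HA j, r ∈ LinearMap.range
            (TensorProduct.map (TensorProduct.lift (cupA 1 1 2 rfl)) (LinearMap.id : HA j →ₗ[k] HA j)) →
          TensorProduct.map LinearMap.id ((cupA j 1 (j + 1) rfl).flip (v j)) r ∈ LinearMap.range
            (TensorProduct.map (TensorProduct.lift (cupA 1 1 2 rfl)) (LinearMap.id : HA (j + 1) →ₗ[k] HA (j + 1))) := by
        rintro r ⟨u, rfl⟩
        induction u using TensorProduct.induction_on with
        | zero => rw [map_zero, map_zero]; exact zero_mem _
        | tmul c z =>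
          refine ⟨c ⊗ₜ (cupA j 1 (j + 1) rfl z (v j)), ?_⟩
          rw [TensorProduct.map_tmul, TensorProduct.map_tmul, TensorProduct.map_tmul, LinearMap.flip_apply,
            LinearMap.id_apply, LinearMap.id_apply, LinearMap.id_apply]
        | add s s' hs hs' => rw [map_add, map_add]; exact add_mem hs hs'
      have hx : TensorProduct.map LinearMap.id ((cupA j 1 (j + 1) rfl).flip (v j)) (x ⊗ₜ ω j) = x ⊗ₜ ω (j + 1) := by
        rw [TensorProduct.map_tmul, LinearMap.id_apply, LinearMap.flip_apply, hωs]
      have hsplit : ((-1 : k) ^ (j + 1)) • TensorProduct.map ((cupA 1 1 2 rfl).flip (v j)) LinearMap.id (t (1, j + 1)) +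
            TensorProduct.map LinearMap.id ((cupA j 1 (j + 1) rfl).flip (v j)) (t (2, j)) - x ⊗ₜ ω (j + 1) =
          ((-1 : k) ^ (j + 1)) • TensorProduct.map ((cupA 1 1 2 rfl).flip (v j)) LinearMap.id (t (1, j + 1)) +
            TensorProduct.map LinearMap.id ((cupA j 1 (j + 1) rfl).flip (v j)) (t (2, j) - x ⊗ₜ ω j) := by
        rw [map_sub, hx]
        exact (add_sub_assoc _ _ _)
      rw [hsplit]
      exact add_mem (Submodule.smul_mem _ _ (hfirst _)) (hsecond _ hmem)
  -- at `j = M = N - 1` the class `y` has degree `N + 1` and vanishes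
  obtain ⟨y, t, ht, hmem⟩ := inv M
  have hy : y = 0 := hN (M + 2) (by omega) y
  rw [hy, map_zero] at ht
  have ht2 : t (2, M) = 0 := by
    have h := hinj (ℕ × ℕ) (antidiagonal (M + 2)) (fun i => i) (Set.injOn_of_injective Function.injective_id)
      (M + 2) t ht.symm (2, M) (mem_antidiagonal.mpr (by omega)) (by show 2 + M = M + 2; omega)
    exact h
  rw [ht2, zero_sub] at hmem
  have hmem' : x ⊗ₜ[k] ω M ∈ LinearMap.range
      (TensorProduct.map (TensorProduct.lift (cupA 1 1 2 rfl)) (LinearMap.id : HA M →ₗ[k] HA M)) := by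
    simpa using Submodule.neg_mem _ hmem
  exact mem_range_of_tmul_mem_range_map _ hωM hmem'


end TopDegree

end Literature.Algebra.Bialgebra
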